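import Literature.AlgebraicGeometry.Modules.IndexedFrames
import Literature.AlgebraicGeometry.Modules.LineBundleOfCocycleClass
import Literature.AlgebraicGeometry.Modules.FiniteAffineTrivialisingCover
import Literature.AlgebraicGeometry.Morphisms.CechH1
import Mathlib.AlgebraicGeometry.Morphisms.Flat
import Mathlib.AlgebraicGeometry.Morphisms.Separated
import HarnessLib

/-!
# Frames toolkit for Step (I): unit frames with transition functions `1`, affine trivialising covers with affine
# intersections, flat sections over affine opens

Layer `Literature/AlgebraicGeometry/Morphisms`, namespace `Literature.AlgebraicGeometry.Morphisms.CechUnitCocycle` (with two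
dot-notation extensions of ★ `Literature.AlgebraicGeometry.Modules.IFrames` declared by absolute name).  THEOREMS ONLY (no definition,
no named fact, no instance, no notation).  Cell `hodgecm-mathlib` (D-0151), F-2d road (R-def) «theorem of the cube over a NON-reduced
base», brick D5b-α (author B-p07 (g16)): the three pieces of plumbing between a line bundle on a flat family `f : X → Spec A` and the
hypotheses of the cocycle Step (I) ★ `Morphisms/CechUnitCocycleTwoFaceLift` / `…Tower` / `…BaseChangeModelData`:

* §1 **`IFrames.tf_unitFrames`** — the frames `freePUnitIso (W a)` (★ `LineBundleOfCocycleClass`) of the structure sheaf have transition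
  functions `1`; **`IFrames.exists_tf_eq_one_of_iso_unit`** — hence a module isomorphic to `𝒪` has frames on ANY family of opens with
  transition functions `1` (★ `IFrames.mapIso`): the model cocycle of such frames is the trivial cocycle `t` (`t_{ij} = 1`) of ★ Č4c;
* §2 `isAffineOpen_inf_of_isSeparated_of_isAffine` — intersections of affine opens of a scheme separated over an affine base are affine
  (Mathlib `isAffineHom_diagonal_iff`); **`exists_affine_cover_iframes`** — a rank-one module on a quasi-compact such scheme has frames on a
  finite cover by affine opens with affine double and triple intersections (★ `exists_finite_affine_trivialising_cover`);
* §3 **`flat_sections_of_isAffineOpen`** — for `f : X → Spec A` flat and `V ⊆ X` affine open, `Γ(V, 𝒪_X)` is a flat `A`-module (Mathlib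
  `HasRingHomProperty` for `@Flat`) — the hypothesis `hfl` of ★ Č1′ `CechUnitCocycleResidueAffineCover` («affine opens have flat sections»).

HC_CM is proved only modulo the 7 printed citations until rung 0 closes; nothing here is about HC.

## References
* [GortzWedhorn2020] U. Görtz, T. Wedhorn, *Algebraic Geometry I*, 2nd ed. (2020), Prop. 11.15 and Remark 11.16, (11.6) (line bundles by cocycles).
* [Hartshorne1977] R. Hartshorne, *Algebraic Geometry* (1977), II §5 (p. 109) and Ex. II.5.16, III Prop. 9.2 (flat morphisms).
* [StacksProject] The Stacks Project, Tag 01KP (separated: intersections of affines), Tag 01U2 (flat morphisms).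
-/

noncomputable section

universe u v

open CategoryTheory AlgebraicGeometry TopologicalSpace Opposite
open Literature.AlgebraicGeometry.Modules Literature.AlgebraicGeometry.Motives

/-! ## §1 Frames of the structure sheaf and of trivial line bundles -/

namespace Literature.AlgebraicGeometry.Modules.IFrames

variable {Y : Scheme.{u}} {ι : Type v} (W : ι → Y.Opens)

/-- **The canonical frames `𝒪^{PUnit} ≅ 𝒪|_{W_a}` of the structure sheaf have transition functions `1`** (both basis sections are
`1`, and the coordinate of `1` in the frame with basis section `1` is `1`). [cite: GortzWedhorn2020, Prop. 11.15 and Remark 11.16] -/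
theorem tf_unitFrames (a b : ι) :
    (⟨fun a => freePUnitIso (W a)⟩ : IFrames (unitModule Y) W).tf a b = 1 := by
  change transitionDet (freePUnitIso (W a)) (freePUnitIso (W b)) punitEnum punitEnum
    (homOfLE (inf_le_left : W a ⊓ W b ≤ W a)) (homOfLE (inf_le_right : W a ⊓ W b ≤ W b)) = 1
  rw [transitionDet_eq, Matrix.det_unique, stdTransition_apply, transition_apply]
  have hu : ∀ z : (PUnit : Type u), z = PUnit.unit := fun z => rfl
  rw [hu (punitEnum.symm default)]
  have h1 : (unitModule Y).presheaf.map (homOfLE (inf_le_right : W a ⊓ W b ≤ W b)).op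
        (basisSection (E := unitModule Y) (freePUnitIso (W b)) PUnit.unit) =
      (unitModule Y).presheaf.map (homOfLE (inf_le_left : W a ⊓ W b ≤ W a)).op
        (basisSection (E := unitModule Y) (freePUnitIso (W a)) PUnit.unit) := by
    rw [← one_eq_basisSection_freePUnitIso, ← one_eq_basisSection_freePUnitIso]
    change (Y.presheaf.map (homOfLE (inf_le_right : W a ⊓ W b ≤ W b)).op).hom (1 : Γ(Y, W b)) =
      (Y.presheaf.map (homOfLE (inf_le_left : W a ⊓ W b ≤ W a)).op).hom (1 : Γ(Y, W a))
    rw [map_one, map_one]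
  classical
  rw [h1, coord_map_basisSection, if_pos rfl]

variable {W} in
/-- **A module isomorphic to the structure sheaf has frames with transition functions `1` on any family of opens** (transport the
canonical frames of `𝒪` along the isomorphism; ★ `tf_mapIso`). Its model cocycle for any ★ `ModelData` is then the trivial
cocycle `t_{ij} = 1`. [cite: GortzWedhorn2020, Prop. 11.15 and Remark 11.16] -/
theorem exists_tf_eq_one_of_iso_unit {M : Y.Modules} (ψ : unitModule Y ≅ M) :
    ∃ G : IFrames M W, ∀ a b, G.tf a b = 1 :=
  ⟨(⟨fun a => freePUnitIso (W a)⟩ : IFrames (unitModule Y) W).mapIso ψ, fun a b => by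
    rw [tf_mapIso, tf_unitFrames]⟩

end Literature.AlgebraicGeometry.Modules.IFrames

namespace Literature.AlgebraicGeometry.Morphisms

namespace CechUnitCocycle

/-! ## §2 Affine trivialising covers with affine intersections -/

/-- **Intersections of affine opens are affine** in a scheme separated over an affine scheme (Mathlib `isAffineHom_diagonal_iff`
applied with the affine open `⊤` of the base). [cite: StacksProject, Tag 01KP] -/
theorem isAffineOpen_inf_of_isSeparated_of_isAffine {X S : Scheme.{u}} (f : X ⟶ S) [IsSeparated f] [IsAffine S]
    {V W : X.Opens} (hV : IsAffineOpen V) (hW : IsAffineOpen W) : IsAffineOpen (V ⊓ W) :=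
  isAffineHom_diagonal_iff.mp (inferInstance : IsAffineHom (Limits.pullback.diagonal f)) ⊤ (isAffineOpen_top S)
    V le_top W le_top hV hW

/-- **A rank-one module on a quasi-compact scheme separated over an affine scheme has frames on a finite cover by affine opens
whose double and triple intersections are affine** (★ `exists_finite_affine_trivialising_cover` + the previous lemma) — the cover
`𝒰` on which the cocycle Step (I) runs. [cite: Hartshorne1977, II §5 (p. 109) and Ex. II.5.16] -/
theorem exists_affine_cover_iframes {X S : Scheme.{u}} (f : X ⟶ S) [IsSeparated f] [IsAffine S] [CompactSpace X]
    (M : X.Modules) (hM : HasRank M 1) :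
    ∃ (ι : Type u) (_ : Finite ι) (U : ι → X.Opens), (∀ a, IsAffineOpen (U a)) ∧ (∀ a b, IsAffineOpen (U a ⊓ U b)) ∧
      (∀ a b c, IsAffineOpen (U a ⊓ U b ⊓ U c)) ∧ ⨆ a, U a = ⊤ ∧ Nonempty (IFrames M U) := by
  obtain ⟨ι, hι, U, hU, hcov, hfr⟩ := exists_finite_affine_trivialising_cover X M hM
  refine ⟨ι, hι, U, hU, fun a b => isAffineOpen_inf_of_isSeparated_of_isAffine f (hU a) (hU b), fun a b c =>
    isAffineOpen_inf_of_isSeparated_of_isAffine f (isAffineOpen_inf_of_isSeparated_of_isAffine f (hU a) (hU b)) (hU c),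
    hcov, ⟨⟨fun a => (hfr a).some⟩⟩⟩

/-! ## §3 Flat sections over affine opens -/

/-- **Affine opens of a flat `A`-scheme have flat sections**: for `f : X → Spec A` flat and `V ⊆ X` an affine open, the `A`-module
`Γ(V, 𝒪_X)` (★ `Sections f V`, `A`-structure through `f`) is flat (flatness of a ring map is affine-local: Mathlib
`HasRingHomProperty.appLE` for `@Flat`, composed with `Γ(Spec A) ≅ A`). This is the hypothesis
`hfl : ∀ V, IsAffineOpen V → Module.Flat A (Sections f V)` of ★ Č1′ `CechUnitCocycleResidueAffineCover`.
[cite: Hartshorne1977, III Prop. 9.2] [cite: StacksProject, Tag 01U2] -/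
theorem flat_sections_of_isAffineOpen {A : Type u} [CommRing A] {X : Scheme.{u}} (f : X ⟶ Spec (.of A)) [Flat f]
    {V : X.Opens} (hV : IsAffineOpen V) : Module.Flat A (Sections f V) := by
  have h1 : (f.appLE ⊤ V le_top).hom.Flat :=
    HasRingHomProperty.appLE (P := @Flat) f inferInstance ⟨⊤, isAffineOpen_top _⟩ ⟨V, hV⟩ le_top
  have h2 : (algebraMap A (Sections f V)).Flat := by
    have e : algebraMap A (Sections f V) = (f.appLE ⊤ V le_top).hom.comp (Scheme.ΓSpecIso (.of A)).inv.hom := rfl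
    rw [e]
    exact RingHom.Flat.comp (RingHom.Flat.of_bijective (Scheme.ΓSpecIso (.of A)).symm.commRingCatIsoToRingEquiv.bijective) h1
  exact RingHom.flat_algebraMap_iff.mp h2

/-- **All affine opens of a flat `A`-scheme have flat sections** (the `hfl` hypothesis of ★ Č1′ in its exact shape).
[cite: StacksProject, Tag 01U2] -/
theorem forall_flat_sections_of_isAffineOpen {A : Type u} [CommRing A] {X : Scheme.{u}} (f : X ⟶ Spec (.of A)) [Flat f] :
    ∀ V : X.Opens, IsAffineOpen V → Module.Flat A (Sections f V) :=
  fun _ hV => flat_sections_of_isAffineOpen f hV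

end CechUnitCocycle

end Literature.AlgebraicGeometry.Morphisms

end
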